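import Summits.HodgeConjecture.CorCM.Census.CentralSquaresSwapCalculus

/-!
# The square-central class, V: exchange of frames — a strict lowering cover, the base block and the swap seen from another base type

COR-CM (cell `pub-hodgecm2`), count-neutral kernel combinatorics by the binder seat b09 (gen 45; lane SQUARE-CENTRAL CLASS, part V), model-free
bookkeeping on parts I and III (`Census/CentralSquaresStrictCover.lean`, `Census/CentralSquaresSwapCalculus.lean`) and gen 38ʼs `bpot`, all BY NAME.
Theorems only: no definition, no `decide`, no certificate, no named fact, no `sorry`.  HONEST FRAMING: `HC_CM` is NOT proved, here or anywhere in the tree;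
nothing here is a period or a headline.

Part IV proves star normal forms toward the base type `T₀` of a frame `(T₀; T₁, Q)`.  The normal forms toward `T₁` (and toward `T̄₁` in the companion
frame `(T₀; T̄₁, c·Q)`) are the SAME theorem in the exchanged frame `(T₁; T₀, Q)`; this file moves every hypothesis across frames.

* §1 `exists_type_of_dev`: every subset of `T₀` is the deviation set of a type.
* §2 `sdiff_eq_of_dev` (**deviations from `T₁` via deviations from `T₀`**): `T₁ ∖ X = (D(X) ∖ 𝓗) ∪ c·(𝓗 ∖ D(X))` (`𝓗 = T₀ ∖ T₁`, `D(X) = T₀ ∖ X`).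
* §3 `bpot_frame`: the base-block potential does not depend on the base type chosen in its block: `bpot (T₀·R⁻¹) = bpot T₀`.
* §4 **The strict lowering cover in another frame** (`cover_frame`): part Iʼs strict lowering property relative to `T₀` implies the same property relative to
  any base change `T₀·R⁻¹` (`unique_frame`, `unique_frame'` move the uniqueness clauses).
* §5 **The swap in the exchanged frame** (`swap_preserves_frame`, `transversal_frame`): if the place permutation of `Q` preserves `𝓗` on `T₀`-representatives,
  it preserves `T₁ ∖ T₀` on `T₁`-representatives, and `c·(𝓗 ∖ T)` is a transversal on `T₁ ∖ T₀` whenever `T` is one on `𝓗`; `card_sdiff_frame`: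
  `|T₁ ∖ T₀| = |𝓗|`.

## References
* [Pohlmann1968] H. Pohlmann, Algebraic cycles on abelian varieties of complex multiplication type, Ann. of Math. 88 (1968), Thm 1.
-/

namespace Summit.HodgeConjecture.CorCM.Census.CentralSquares

open Finset
open scoped symmDiff
open Summit.HodgeConjecture.CorCM.Prior.AllgGroup.RfwfAllgGroup
open Summit.HodgeConjecture.CorCM.Census.BlockParity
open Summit.HodgeConjecture.CorCM.Census.Coinvariant
open Summit.HodgeConjecture.CorCM.Census.TwistGeneration
open Summit.HodgeConjecture.CorCM.Census.BaseBlock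

noncomputable section

variable {G : Type*} [Group G] [Fintype G] [DecidableEq G] (c : G)

/-! ## §1 Types with prescribed deviation set -/

/-- **Every subset of `T₀` is the deviation set of a type** (flip `T₀` at its places one by one). [folklore] -/
theorem exists_type_of_dev (hc2 : c * c = 1) (T₀ : CMF G c) (D : Finset G) (hD : D ⊆ T₀.1) : ∃ X : CMF G c, T₀.1 \ X.1 = D := by
  classical
  induction D using Finset.induction_on with
  | empty => exact ⟨T₀, Finset.sdiff_self _⟩
  | insert s D hs ih =>
    obtain ⟨X, hX⟩ := ih ((subset_insert s D).trans hD)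
    have hsT : s ∈ T₀.1 := hD (mem_insert_self s D)
    have hsX : s ∈ X.1 := by
      by_contra h
      have : s ∈ T₀.1 \ X.1 := mem_sdiff.mpr ⟨hsT, h⟩
      rw [hX] at this; exact hs this
    exact ⟨oflipCM c hc2 s X, by rw [dev_oflip_of_mem c hc2 hsT hsX, hX]⟩

/-! ## §2 Deviations from `T₁` via deviations from `T₀` -/

/-- **Deviations from `T₁` via deviations from `T₀`**: `T₁ ∖ X = (D(X) ∖ 𝓗) ∪ c·(𝓗 ∖ D(X))` with `𝓗 = T₀ ∖ T₁`, `D(X) = T₀ ∖ X`; the union is disjoint.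
[folklore] -/
theorem sdiff_eq_of_dev (hc2 : c * c = 1) (T₀ T₁ X : CMF G c) :
    T₁.1 \ X.1 = ((T₀.1 \ X.1) \ (T₀.1 \ T₁.1)) ∪ ((T₀.1 \ T₁.1) \ (T₀.1 \ X.1)).image (fun t => c * t) := by
  ext x
  simp only [mem_union, mem_sdiff, mem_image, not_and, not_not]
  constructor
  · rintro ⟨hx1, hxX⟩
    by_cases hx0 : x ∈ T₀.1
    · exact Or.inl ⟨⟨hx0, hxX⟩, fun _ => hx1⟩
    · refine Or.inr ⟨c * x, ⟨⟨?_, (T₁.2 x).mp hx1⟩, fun _ => ?_⟩, cmul_cmul c hc2 x⟩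
      · by_contra h; exact hx0 ((T₀.2 x).mpr h)
      · by_contra h; exact hxX ((X.2 x).mpr h)
  · rintro (⟨⟨hx0, hxX⟩, himp⟩ | ⟨t, ⟨⟨ht0, ht1⟩, himp⟩, rfl⟩)
    · exact ⟨himp hx0, hxX⟩
    · refine ⟨?_, (X.2 t).mp (himp ht0)⟩
      by_contra h; exact ht1 ((T₁.2 t).mpr h)

/-- The two pieces are disjoint (one inside `T₀`, the other outside). [folklore] -/
theorem disjoint_dev_pieces (T₀ : CMF G c) (A B : Finset G) (hA : A ⊆ T₀.1) (hB : B ⊆ T₀.1) :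
    Disjoint A (B.image fun t => c * t) := by
  rw [disjoint_iff_ne]
  rintro x hx _ hy rfl
  obtain ⟨t, ht, rfl⟩ := mem_image.mp hy
  exact ((T₀.2 t).mp (hB ht)) (hA hx)

/-! ## §3 The potential in another frame -/

/-- **The base-block potential is frame independent**: `bpot (T₀·R⁻¹) Ψ = bpot T₀ Ψ`. [folklore] -/
theorem bpot_frame (T₀ : CMF G c) (R : G) (Ψ : CMF G c) : bpot c (rt c R T₀) Ψ = bpot c T₀ Ψ := by
  apply le_antisymm
  · obtain ⟨Q, hQ⟩ := exists_bpot_eq c T₀ Ψ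
    have h := bpot_le c (rt c R T₀) Ψ (Q * R⁻¹)
    rwa [← rt_mul, inv_mul_cancel_right, ← hQ] at h
  · obtain ⟨Q, hQ⟩ := exists_bpot_eq c (rt c R T₀) Ψ
    have h := bpot_le c T₀ Ψ (Q * R)
    rwa [rt_mul, ← hQ] at h

/-! ## §4 The strict lowering cover in another frame -/

/-- Uniqueness of the nearest base change, moved to the frame `T₀·R⁻¹`. [folklore] -/
theorem unique_frame (T₀ : CMF G c) (R : G) {Y : CMF G c} {Q₂ : G}
    (h : ∀ Q' : G, ddist (rt c Q' T₀) Y = bpot c T₀ Y → rt c Q' T₀ = rt c Q₂ T₀) :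
    ∀ Q' : G, ddist (rt c Q' (rt c R T₀)) Y = bpot c (rt c R T₀) Y → rt c Q' (rt c R T₀) = rt c (Q₂ * R⁻¹) (rt c R T₀) := by
  intro Q' hQ'
  rw [← rt_mul, bpot_frame] at hQ'
  rw [← rt_mul, ← rt_mul, inv_mul_cancel_right, h _ hQ']

/-- Uniqueness of the nearest base change, moved back from the frame `T₀·R⁻¹`. [folklore] -/
theorem unique_frame' (T₀ : CMF G c) (R : G) {Y : CMF G c} {Q₁ : G}
    (h : ∀ Q' : G, ddist (rt c Q' (rt c R T₀)) Y = bpot c (rt c R T₀) Y → rt c Q' (rt c R T₀) = rt c Q₁ (rt c R T₀)) :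
    ∀ Q' : G, ddist (rt c Q' T₀) Y = bpot c T₀ Y → rt c Q' T₀ = rt c (Q₁ * R) T₀ := by
  intro Q' hQ'
  have e : rt c Q' T₀ = rt c (Q' * R⁻¹) (rt c R T₀) := by rw [← rt_mul, inv_mul_cancel_right]
  rw [e, ← bpot_frame c T₀ R] at hQ'
  rw [e, h _ hQ', rt_mul]

/-- **THE STRICT LOWERING COVER IN ANOTHER FRAME.**  Part Iʼs export (lowering through every far type, strict wherever strictness is available) relative to
`T₀` implies the same export relative to any base change `T₀·R⁻¹`. [folklore] -/
theorem cover_frame (hc2 : c * c = 1) (T₀ : CMF G c) (L : Submodule ℤ (CMF G c →₀ ℤ)) (R : G)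
    (hcover : ∀ Ψ : CMF G c, 2 ≤ bpot c T₀ Ψ → ∃ Q₂ s s' : G, bpot c T₀ Ψ = ddist (rt c Q₂ T₀) Ψ ∧
      s ∈ (rt c Q₂ T₀).1 \ Ψ.1 ∧ s' ∈ (rt c Q₂ T₀).1 \ Ψ.1 ∧ s ≠ s' ∧ gface c hc2 Ψ s s' ∈ L ∧
      ((∃ Q₁ t t' : G, bpot c T₀ Ψ = ddist (rt c Q₁ T₀) Ψ ∧ t ∈ (rt c Q₁ T₀).1 \ Ψ.1 ∧ t' ∈ (rt c Q₁ T₀).1 \ Ψ.1 ∧ t ≠ t' ∧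
          (∀ Q' : G, ddist (rt c Q' T₀) (oflipCM c hc2 t Ψ) = bpot c T₀ (oflipCM c hc2 t Ψ) → rt c Q' T₀ = rt c Q₁ T₀) ∧
          (∀ Q' : G, ddist (rt c Q' T₀) (oflipCM c hc2 t' Ψ) = bpot c T₀ (oflipCM c hc2 t' Ψ) → rt c Q' T₀ = rt c Q₁ T₀) ∧
          (∀ Q' : G, ddist (rt c Q' T₀) (oflipCM c hc2 t (oflipCM c hc2 t' Ψ)) = bpot c T₀ (oflipCM c hc2 t (oflipCM c hc2 t' Ψ)) →
            rt c Q' T₀ = rt c Q₁ T₀)) →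
        (∀ Q' : G, ddist (rt c Q' T₀) (oflipCM c hc2 s Ψ) = bpot c T₀ (oflipCM c hc2 s Ψ) → rt c Q' T₀ = rt c Q₂ T₀) ∧
        (∀ Q' : G, ddist (rt c Q' T₀) (oflipCM c hc2 s' Ψ) = bpot c T₀ (oflipCM c hc2 s' Ψ) → rt c Q' T₀ = rt c Q₂ T₀) ∧
        (∀ Q' : G, ddist (rt c Q' T₀) (oflipCM c hc2 s (oflipCM c hc2 s' Ψ)) = bpot c T₀ (oflipCM c hc2 s (oflipCM c hc2 s' Ψ)) →
          rt c Q' T₀ = rt c Q₂ T₀))) :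
    ∀ Ψ : CMF G c, 2 ≤ bpot c (rt c R T₀) Ψ → ∃ Q₂ s s' : G, bpot c (rt c R T₀) Ψ = ddist (rt c Q₂ (rt c R T₀)) Ψ ∧
      s ∈ (rt c Q₂ (rt c R T₀)).1 \ Ψ.1 ∧ s' ∈ (rt c Q₂ (rt c R T₀)).1 \ Ψ.1 ∧ s ≠ s' ∧ gface c hc2 Ψ s s' ∈ L ∧
      ((∃ Q₁ t t' : G, bpot c (rt c R T₀) Ψ = ddist (rt c Q₁ (rt c R T₀)) Ψ ∧ t ∈ (rt c Q₁ (rt c R T₀)).1 \ Ψ.1 ∧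
          t' ∈ (rt c Q₁ (rt c R T₀)).1 \ Ψ.1 ∧ t ≠ t' ∧
          (∀ Q' : G, ddist (rt c Q' (rt c R T₀)) (oflipCM c hc2 t Ψ) = bpot c (rt c R T₀) (oflipCM c hc2 t Ψ) →
            rt c Q' (rt c R T₀) = rt c Q₁ (rt c R T₀)) ∧
          (∀ Q' : G, ddist (rt c Q' (rt c R T₀)) (oflipCM c hc2 t' Ψ) = bpot c (rt c R T₀) (oflipCM c hc2 t' Ψ) →
            rt c Q' (rt c R T₀) = rt c Q₁ (rt c R T₀)) ∧
          (∀ Q' : G, ddist (rt c Q' (rt c R T₀)) (oflipCM c hc2 t (oflipCM c hc2 t' Ψ)) = bpot c (rt c R T₀) (oflipCM c hc2 t (oflipCM c hc2 t' Ψ)) →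
            rt c Q' (rt c R T₀) = rt c Q₁ (rt c R T₀))) →
        (∀ Q' : G, ddist (rt c Q' (rt c R T₀)) (oflipCM c hc2 s Ψ) = bpot c (rt c R T₀) (oflipCM c hc2 s Ψ) →
          rt c Q' (rt c R T₀) = rt c Q₂ (rt c R T₀)) ∧
        (∀ Q' : G, ddist (rt c Q' (rt c R T₀)) (oflipCM c hc2 s' Ψ) = bpot c (rt c R T₀) (oflipCM c hc2 s' Ψ) →
          rt c Q' (rt c R T₀) = rt c Q₂ (rt c R T₀)) ∧
        (∀ Q' : G, ddist (rt c Q' (rt c R T₀)) (oflipCM c hc2 s (oflipCM c hc2 s' Ψ)) = bpot c (rt c R T₀) (oflipCM c hc2 s (oflipCM c hc2 s' Ψ)) →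
          rt c Q' (rt c R T₀) = rt c Q₂ (rt c R T₀))) := by
  intro Ψ h2
  rw [bpot_frame] at h2
  obtain ⟨Q₂, s, s', hQ₂, hs, hs', hss', hmem, hstr⟩ := hcover Ψ h2
  have e : rt c (Q₂ * R⁻¹) (rt c R T₀) = rt c Q₂ T₀ := by rw [← rt_mul, inv_mul_cancel_right]
  refine ⟨Q₂ * R⁻¹, s, s', by rw [bpot_frame, e]; exact hQ₂, by rw [e]; exact hs, by rw [e]; exact hs', hss', hmem, fun hex => ?_⟩
  obtain ⟨Q₁, t, t', h1, ht, ht', htt', hu1, hu2, hu3⟩ := hex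
  have e1 : rt c Q₁ (rt c R T₀) = rt c (Q₁ * R) T₀ := by rw [rt_mul]
  obtain ⟨k1, k2, k3⟩ := hstr ⟨Q₁ * R, t, t', by rw [← e1, ← bpot_frame c T₀ R]; exact h1, by rw [← e1]; exact ht,
    by rw [← e1]; exact ht', htt', unique_frame' c T₀ R hu1, unique_frame' c T₀ R hu2, unique_frame' c T₀ R hu3⟩
  exact ⟨unique_frame c T₀ R k1, unique_frame c T₀ R k2, unique_frame c T₀ R k3⟩

/-! ## §5 The swap in the exchanged frame -/

/-- **`|T₁ ∖ T₀| = |T₀ ∖ T₁|`** (the two deviation sets are exchanged by `x ↦ c·x`). [folklore] -/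
theorem card_sdiff_frame (hc2 : c * c = 1) (T₀ T₁ : CMF G c) : (T₁.1 \ T₀.1).card = (T₀.1 \ T₁.1).card := by
  have h := sdiff_eq_of_dev c hc2 T₀ T₁ T₀
  rw [Finset.sdiff_self, Finset.empty_sdiff, Finset.empty_union, Finset.sdiff_empty] at h
  rw [h, card_image_of_injective _ (mul_right_injective c)]

/-- **The swap preserves `T₁ ∖ T₀` on `T₁`-representatives** when it preserves `𝓗 = T₀ ∖ T₁` on `T₀`-representatives. [folklore] -/
theorem swap_preserves_frame (hc2 : c * c = 1) (T₀ T₁ : CMF G c) (Q : G)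
    (hσH : ∀ t ∈ T₀.1, ∀ t' ∈ T₀.1, (t' = t * Q ∨ t' = c * (t * Q)) → (t ∈ T₀.1 \ T₁.1 ↔ t' ∈ T₀.1 \ T₁.1)) :
    ∀ t ∈ T₁.1, ∀ t' ∈ T₁.1, (t' = t * Q ∨ t' = c * (t * Q)) → (t ∈ T₁.1 \ T₀.1 ↔ t' ∈ T₁.1 \ T₀.1) := by
  intro t ht t' ht' h
  -- the `T₀`-representatives of the places of `t` and of `t·Q`
  obtain ⟨u, hu, hu'⟩ := exists_rep c T₀.2 t
  obtain ⟨u', hu'0, hu''⟩ := exists_rep c T₀.2 (t * Q)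
  -- `u' ` represents the place of `u·Q` as well
  have hrep : u' = u * Q ∨ u' = c * (u * Q) := by
    rcases hu' with rfl | rfl
    · exact hu''
    · rcases hu'' with h1 | h1
      · right; rw [h1, mul_assoc, ← mul_assoc c c, hc2, one_mul]
      · left; rw [h1, mul_assoc]
  have key := hσH u hu u' hu'0 hrep
  -- translate membership statements
  have e1 : t ∈ T₁.1 \ T₀.1 ↔ u ∈ T₀.1 \ T₁.1 := by
    rw [mem_sdiff, mem_sdiff]
    rcases hu' with rfl | rfl
    · constructor
      · rintro ⟨-, h0⟩; exact absurd hu h0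
      · rintro ⟨-, h1⟩; exact absurd ht h1
    · constructor
      · rintro ⟨-, -⟩; exact ⟨hu, (T₁.2 t).mp ht⟩
      · rintro ⟨-, -⟩; exact ⟨ht, fun h0 => ((T₀.2 t).mp h0) hu⟩
  have e2 : t' ∈ T₁.1 \ T₀.1 ↔ u' ∈ T₀.1 \ T₁.1 := by
    rw [mem_sdiff, mem_sdiff]
    -- `t'` and `u'` represent the same place
    have hsame : u' = t' ∨ u' = c * t' := by
      rcases h with rfl | rfl <;> rcases hu'' with h1 | h1
      · exact Or.inl h1
      · exact Or.inr h1
      · right; rw [h1, ← mul_assoc, hc2, one_mul]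
      · exact Or.inl h1
    rcases hsame with rfl | rfl
    · constructor
      · rintro ⟨-, h0⟩; exact absurd hu'0 h0
      · rintro ⟨-, h1⟩; exact absurd ht' h1
    · constructor
      · rintro ⟨-, -⟩; exact ⟨hu'0, (T₁.2 t').mp ht'⟩
      · rintro ⟨-, -⟩; exact ⟨ht', fun h0 => ((T₀.2 t').mp h0) hu'0⟩
  rw [e1, e2]; exact key

/-- **Transversals in the exchanged frame**: if `T ⊆ 𝓗` is a transversal of the swap on `𝓗` (on `T₀`-representatives), then `c·(𝓗 ∖ T)` is a transversal
of the swap on `T₁ ∖ T₀` (on `T₁`-representatives). [folklore] -/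
theorem transversal_frame (hc2 : c * c = 1) (T₀ T₁ : CMF G c) (Q : G)
    (hσH : ∀ t ∈ T₀.1, ∀ t' ∈ T₀.1, (t' = t * Q ∨ t' = c * (t * Q)) → (t ∈ T₀.1 \ T₁.1 ↔ t' ∈ T₀.1 \ T₁.1))
    (T : Finset G)
    (hT : ∀ t ∈ T₀.1 \ T₁.1, ∀ t' ∈ T₀.1, (t' = t * Q ∨ t' = c * (t * Q)) → (t ∈ T ↔ t' ∉ T)) :
    ∀ t ∈ T₁.1 \ T₀.1, ∀ t' ∈ T₁.1, (t' = t * Q ∨ t' = c * (t * Q)) →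
      (t ∈ ((T₀.1 \ T₁.1) \ T).image (fun x => c * x) ↔ t' ∉ ((T₀.1 \ T₁.1) \ T).image (fun x => c * x)) := by
  intro t ht t' ht' h
  obtain ⟨ht1, ht0⟩ := mem_sdiff.mp ht
  -- `t = c·u` with `u ∈ 𝓗`
  have hu : c * t ∈ T₀.1 := by by_contra h0; exact ht0 ((T₀.2 t).mpr h0)
  have huH : c * t ∈ T₀.1 \ T₁.1 := mem_sdiff.mpr ⟨hu, (T₁.2 t).mp ht1⟩
  -- the `T₀`-representative `u'` of the place of `t·Q`, and of `(c·t)·Q`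
  obtain ⟨u', hu'0, hu''⟩ := exists_rep c T₀.2 (t * Q)
  have hrep : u' = c * t * Q ∨ u' = c * (c * t * Q) := by
    rcases hu'' with h1 | h1
    · right; rw [h1, mul_assoc, ← mul_assoc c c, hc2, one_mul]
    · left; rw [h1, mul_assoc]
  have hu'H : u' ∈ T₀.1 \ T₁.1 := (hσH _ hu u' hu'0 hrep).mp huH
  have key := hT _ huH u' hu'0 hrep
  -- `t'` is the `T₁`-representative of the same place as `u'`, and that place lies in `𝓗`, so `t' = c·u'`
  have ht'eq : t' = c * u' := by
    have hsame : u' = t' ∨ u' = c * t' := by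
      rcases h with rfl | rfl <;> rcases hu'' with h1 | h1
      · exact Or.inl h1
      · exact Or.inr h1
      · right; rw [h1, ← mul_assoc, hc2, one_mul]
      · exact Or.inl h1
    rcases hsame with h1 | h1
    · exact absurd (h1 ▸ ht') (mem_sdiff.mp hu'H).2
    · rw [h1, ← mul_assoc, hc2, one_mul]
  -- membership in the image
  have himg : ∀ x : G, c * x ∈ T₀.1 → (x ∈ ((T₀.1 \ T₁.1) \ T).image (fun y => c * y) ↔ c * x ∈ (T₀.1 \ T₁.1) \ T) := by
    intro x hx
    rw [mem_image]
    constructor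
    · rintro ⟨y, hy, hyx⟩
      have : y = c * x := by rw [← hyx, ← mul_assoc, hc2, one_mul]
      rwa [this] at hy
    · intro h1; exact ⟨c * x, h1, by rw [← mul_assoc, hc2, one_mul]⟩
  have hccu : c * (c * u') = u' := by rw [← mul_assoc, hc2, one_mul]
  rw [himg t hu, ht'eq, himg (c * u') (by rw [hccu]; exact hu'0), hccu]
  have h1 := huH
  have h2 := hu'H
  simp only [mem_sdiff] at h1 h2 key ⊢
  tauto

end

end Summit.HodgeConjecture.CorCM.Census.CentralSquares
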